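import Mathlib
import Summits.NavierStokesRegularity.NavierStokesRegularity.Theses.TaoLadderRungTwoFlat
import Summits.NavierStokesRegularity.NavierStokesRegularity.Theorems.TaoLadderRungTwoFlatMirrorTableDefs
import Summits.NavierStokesRegularity.NavierStokesRegularity.Theorems.TaoLadderRungTwoFlatSplitLayerDefs
import HarnessLib

/-!
# Route TaoLadderRungTwoFlat, crux K_A♭ = `FlatGapCertificatesV2` (stmt-NavierStokesRegularity-22987):
  the registered hardest stub `stub_mirrorGapData` of the birth line (skeleton `birth_KA_quarter.lean`,
  sha16 630a5700be442b76) CLOSED MODULO the two split children `MirrorSolitaryWave` (stmt-…-23908) and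
  `GradedAdiabaticWake` (stmt-…-23909)

The split glue `FlatGapOfMirrorLayer` (stmt-…-23910, `Theorems/TaoLadderRungTwoFlatFlatGapOfMirrorLayer.lean`)
concludes the CRUX from the two children. This file records the same composition one level down, at the
REGISTERED STUB: the stub's signature (the `∀ ε₀ ≤ εs` gap data with thin tail for the FIXED table
`mirrorTable ½ ½`, carrier datum `i₀ = 0`, SOME datum `X₀` with `X₀ 0 ≠ 0`) follows from child 1 (the λ₀ = 1
pulse/capture certificate at `datumE3 = (1,2)`) and child 2 (the ε₀-uniform transfer theorem) instantiated at
`ε = 1/2`, `X₀ = datumE3`, `i₀ = 0`, with `εs := min εs (1/2)` for the clause `εs < 1`. So the birth line's stub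
partition {`stub_mirrorGapData`} — the only stub consumed by its composition `FlatGapCertificatesV2_of`; the rung
stubs `stub_rung` (ε₀ = 1/100) and `stub_rung_quarter` (ε₀ = 1/4) are plan-only instances not consumed — is
closed exactly when the two child items close.

HONEST FRAMING: a short composition of two OPEN hypotheses about a MODEL lattice (Tao 2016 §4/§6 cascade
vocabulary on the two-way shift set `S♭`); nothing is certified, no stub and no item is closed by this file,
and nothing here is a statement about the Navier–Stokes equations.
-/

noncomputable section

-- the sub-problem namespace repeats the summit name by design (D-0017)
set_option linter.dupNamespace false

namespace Summit.NavierStokesRegularity.NavierStokesRegularity.Theorems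

open Literature.Analysis.FluidPDE Literature.Analysis.FluidPDE.TaoCascade
open Summit.NavierStokesRegularity.NavierStokesRegularity.Theses.TaoLadderRungTwoFlat

/-- **The registered stub `stub_mirrorGapData` of crux K_A♭ from the two split children.** If the homogeneous
mirror lattice `T♭(½)` carries the λ₀ = 1 pulse/capture certificate at the charged datum (`MirrorSolitaryWave`)
and the ε₀-uniform transfer theorem holds (`GradedAdiabaticWake`), then for some `εs ∈ (0,1)` and every
`ε₀ ∈ (0, εs]` the FIXED table `mirrorTable ½ ½` with carrier datum admits format-v2 gap data on `S♭` with a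
thin tail — the signature of `stub_mirrorGapData` VERBATIM (witness `X₀ := datumE3`, `εs := min εs ½`).
[cite: Tao2016AveragedNS, §6.3–6.4 Props. 6.4–6.5 (statement shape of a renormalisation certificate); route
TaoLadderRungTwoFlat, crux K_A♭, split SPLIT-T48 (children MirrorSolitaryWave / GradedAdiabaticWake)] -/
theorem stub_mirrorGapData_of_split (h₁ : MirrorSolitaryWave) (h₂ : GradedAdiabaticWake) :
    ∃ εs : ℝ, 0 < εs ∧ εs < 1 ∧ ∀ ε₀ : ℝ, 0 < ε₀ → ε₀ ≤ εs →
      ∃ (σ : ℝ) (X₀ : Fin 2 → ℝ) (Z : Set (Fin 2 → ℤ → ℝ)) (w : ℤ → ℝ) (r ρ θ₀ θ c₀ c : ℝ) (env₀ : ℤ → ℝ),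
        X₀ 0 ≠ 0 ∧ GapData₂On shiftSetFlat σ ε₀ (0 : Fin 2) (mirrorTable (1 / 2) (1 / 2)) X₀ Z w r ρ θ₀ θ c₀ c env₀ ∧
          TailThin ε₀ w r := by
  obtain ⟨τ, Φ, g, b, ρ, C, N, hg, hb, hP, hR, hvac, hS2, hS3⟩ := h₁
  have hX : MirrorPulse.datumE3 0 ≠ 0 := by
    simp [MirrorPulse.datumE3]
  obtain ⟨εs, hεs, hall⟩ :=
    h₂ (1 / 2) _ 0 τ Φ g b ρ C N (by norm_num) (by norm_num) hX hg hb hP hR hvac hS2 hS3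
  refine ⟨min εs (1 / 2), lt_min hεs (by norm_num), (min_le_right _ _).trans_lt (by norm_num), ?_⟩
  intro ε₀ h0 hle
  obtain ⟨σ, Z, w, r, ρ', θ₀, θ, c₀, c, env₀, hgap, hthin⟩ := hall ε₀ h0 (hle.trans (min_le_left _ _))
  exact ⟨σ, MirrorPulse.datumE3, Z, w, r, ρ', θ₀, θ, c₀, c, env₀, hX, hgap, hthin⟩

end Summit.NavierStokesRegularity.NavierStokesRegularity.Theorems

end
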